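/-
Copyright: the b2b-balaban T⁴-continuum CRUX team, row NE7b OWNER lineage `t4-ne7b-p1` (gen 129). Project licence.
-/
import Summits.QuantumFields.BalabanUV.T4Continuum.Spine.NE7b.SupMixedRegionHoelder
import Summits.QuantumFields.BalabanUV.T4Continuum.Spine.NE7b.SupLocalisedPolymerGas
import Summits.QuantumFields.BalabanUV.T4Continuum.Spine.NE7b.SupFluctuationAPriori
import Summits.QuantumFields.BalabanUV.T4Continuum.Spine.NE7b.SupRoadFactorRegulated

/-!
# THE SMALL-FIELD GAS IS REAL: on a region `S` where the external field is small on cells, the road's fluctuation integral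
# `∫ e^{−Σ_{p∈S}Σ_{x∈cell p}w_x(ω_x+ψ_x)} dN(0,Γ)` is a POSITIVE REAL number whose REAL logarithm obeys `|log ∫e^{−A}| ≤ #S·(Δ+1)·2e·ε_Ψ(h)A_τ^v`
# — (296)'s bound on the complex Kotecký–Preiss logarithm transported to `Real.log` through `exp(log Z) = Z` ((289)'s KP branch on the
# cut-off shifted factors) and `‖e^z‖ = e^{Re z}`; together with (297)'s a-priori bound read on `log`, these are the PURE quantities that
# (305)'s Hölder sandwich glues into the all-field assembly (307) (row NE7b, node U5c; (296) + (289) + (290) + (297) + (305) BY NAME; [folklore])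

Cell `pub-balaban`, sub-cell `t4`, spine estimate NE7b (`T4WeightBudget.RelWeightBound`; the cell's OWN estimate — NOT PRINTED in
[Bałaban 1983–89], NOT PROVED).  Crux-route work under `Spine/NE7b/` by the row OWNER (`t4-ne7b-p1` gen 129, file (306)) under FREEZE
(0)'s crux-prover clause, on § [NE7bP1-G128-HANDOFF] NEXT (3)(a) («THE ASSEMBLY at one scale for ALL external fields»); NOTHING of
Bałaban's is named as a Lean object, valued or asserted; no `T4Continuum/Support` leaf typed; no `def`, no notation; zero `sorry`.  Imports
(BY NAME): the OWNER's (305) `…SupMixedRegionHoelder` (`le_log_integral_exp_neg_add`), (296) `…SupLocalisedPolymerGas`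
(`shifted_norm_pertLogZ_le_on`, `pertZ_cutoff`, `pertLogZ_cutoff`, `cutoff_measurable`, `cutoff_shifted_regulated`), (292)
(`shifted_measurable`), (289) (`regulated_exp_pertLogZ`), (290) (`road_factor_norm_le`, `road_factor_measurable`, `road_eps_nonneg`), (297)
`…SupFluctuationAPriori` (`integral_exp_neg_le`, `integrable_exp_neg`); the tree's `pertZ`, `pertLogZ`, `symm_of_inst`; Mathlib's
`integral_complex_ofReal`, `Complex.norm_exp`, `Complex.abs_re_le_norm`.

WHY (located; DECISION SCOPING-d3 of this generation, see (305)'s header).  The expansion files bound the COMPLEX KP logarithm `pertLogZ`;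
the assembly by Hölder needs the REAL logarithm of the REAL integral `∫e^{−A}`.  For the road the factors are real, `Z_ψ(S) = ↑∫e^{−A}`,
and on the small-field region the KP branch satisfies `exp(pertLogZ) = Z` — so `Re(pertLogZ) = log ∫e^{−A}` and `|log ∫e^{−A}| ≤ ‖pertLogZ‖`.

WHAT IS PROVED ([folklore]; `μ = N(0,Γ)` on `ι → ℝ`, cells `cell : V → Finset ι` pairwise disjoint of `≤ v` sites, `w_x` measurable):
* §1 bridges: `cellSum_eq_sum_biUnion`, `measurable_cellSum`, `prod_one_add_road_factor` (`∏_{p∈S}(1+g_p(ω+ψ)) = ↑e^{−Σ_{p∈S}Σ_{cell p}w}`),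
  `pertZ_road_shift_eq` (`Z_ψ(S) = ↑∫e^{−A}`), `abs_log_le_norm_of_exp_eq` (`e^z = ↑r`, `r > 0` ⟹ `|log r| ≤ ‖z‖`), **`shifted_exp_pertLogZ_on`**
  (`exp(log Z_ψ(C)) = Z_ψ(C)` for regulated cell-measurable factors and `ψ` small on the cells of `C`), `two_mul_log_sub_le` ((305)'s
  reversed split at `θ = ½`: `2log∫e^{−A} − log∫e^{−(A−B)} ≤ log∫e^{−(A+B)}`);
* §2 THE END: **`abs_log_integral_smallField_le`** — `ψ` small on the cells of `S`, stable (`κ₀`) and cubically small (`c₃` on `|t| ≤ h`)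
  remainders, `2κ₀ ≤ κ`, `κ(1+τ)γ_op ≤ θ < 1`, `e·ε_Ψ(h)A_τ^v(Δ+1)² ≤ 1∕2` ⟹
  `|log ∫e^{−Σ_{p∈S}Σ_{x∈cell p}w_x(ω_x+ψ_x)}dN(0,Γ)| ≤ #S·(Δ+1)·2e·ε_Ψ(h)A_τ^v`, `ε_Ψ(h) = max(e^{c₃vh³}−1, 2e^{−(κ∕2−κ₀)h²})·e^{½κ(1+τ⁻¹)Ψ²}`;
* §3 `log_integral_largeField_le` ((297)'s upper bound read on `log`: `≤ #Y·(2κ₀(1+τ)γ∕(2θ))(−log(1−θ)) + κ₀(1+τ⁻¹)Σ_Yψ²`); §4 toy.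

HONEST (what this is NOT).  Bookkeeping between the complex KP logarithm and the real one, plus (297) on `log`; the assembly itself is
(307); scalar skeleton ((A3), NC-NE7b-α UNRULED); nothing of Bałaban's asserted.  BY-NAME EFFECT ON THE WALL: NONE.  NE7b NOT PRINTED ∕ NOT
PROVED; spine PROVED 0∕9; rung (B)+1 — the programme's measures remain FINITE-torus statements; NOT the mass gap, NOT Clay.  HONEST
DEPENDENCY: continuum YM on T⁴ ⇐ BetaPertH ∧ nine spine estimates (0∕9 proved); BetaPertH ⇐ (D1) ∧ (D4) ∧ CAP+tail; G-an2-4 gates asym, D1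
and NE2∕3∕4.
-/

set_option autoImplicit false

noncomputable section

namespace Summit.QuantumFields.BalabanUV.T4Continuum.NE7b.SupSmallFieldGasReal

open MeasureTheory ProbabilityTheory Finset Real
open scoped BigOperators
open Literature.Probability.LatticeModels (pertZ pertLogZ symm_of_inst)
open Literature.Analysis.Matrix (HasFiniteRange)
open SupMixedRegionHoelder (log_integral_exp_neg_add_le le_log_integral_exp_neg_add integrable_exp_neg_add)
open SupLocalisedPolymerGas (shifted_norm_pertLogZ_le_on pertZ_cutoff pertLogZ_cutoff cutoff_measurable cutoff_shifted_regulated)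
open SupRegulatedActivityShift (shifted_measurable)
open SupRegulatedActivityBound (regulated_exp_pertLogZ)
open SupRoadFactorRegulated (road_factor_norm_le road_factor_measurable road_eps_nonneg)
open SupFluctuationAPriori (integral_exp_neg_le integrable_exp_neg le_integral_exp_neg)

variable {ι : Type} [Fintype ι] [DecidableEq ι] {V : Type*} [DecidableEq V]

/-! ## §1. Bridges -/

omit [Fintype ι] [DecidableEq V] in
/-- A double sum over the cells of `X` is the sum over the sites `⋃_{p∈X} cell p` (pairwise disjoint cells). [folklore] -/
theorem cellSum_eq_sum_biUnion (cell : V → Finset ι) (hdisj : ∀ p q, p ≠ q → Disjoint (cell p) (cell q)) (X : Finset V)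
    (f : ι → ℝ) : ∑ p ∈ X, ∑ x ∈ cell p, f x = ∑ x ∈ X.biUnion cell, f x :=
  (sum_biUnion (fun p _ q _ hpq => hdisj p q hpq)).symm

omit [Fintype ι] [DecidableEq ι] [DecidableEq V] in
/-- The cell sums of measurable remainders at a shifted field are measurable in the field. [folklore] -/
theorem measurable_cellSum (cell : V → Finset ι) (w : ι → ℝ → ℝ) (hw : ∀ x, Measurable (w x)) (X : Finset V) (ψ : ι → ℝ) :
    Measurable fun ω : EuclideanSpace ℝ ι => ∑ p ∈ X, ∑ x ∈ cell p, w x (ω x + ψ x) := by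
  refine Finset.measurable_sum X fun p _ => Finset.measurable_sum (cell p) fun x _ => ?_
  exact (hw x).comp ((by fun_prop : Measurable fun ω : EuclideanSpace ℝ ι => ω x).add_const (ψ x))

omit [Fintype ι] [DecidableEq ι] [DecidableEq V] in
/-- **The road's shifted Gibbs factor as a complex number**: `∏_{p∈S}(1 + (e^{−Σ_{x∈cell p}w_x((ω+ψ)_x)} − 1)) = e^{−Σ_{p∈S}Σ_{x∈cell p}w_x(ω_x+ψ_x)}`.
[folklore] -/
theorem prod_one_add_road_factor (cell : V → Finset ι) (w : ι → ℝ → ℝ) (S : Finset V) (ω ψ : EuclideanSpace ℝ ι) :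
    ∏ p ∈ S, (1 + (((exp (-(∑ x ∈ cell p, w x ((ω + ψ) x))) - 1 : ℝ)) : ℂ)) =
      ((exp (-(∑ p ∈ S, ∑ x ∈ cell p, w x (ω x + ψ x))) : ℝ) : ℂ) := by
  have hcell : ∀ p, ∑ x ∈ cell p, w x ((ω + ψ) x) = ∑ x ∈ cell p, w x (ω x + ψ x) :=
    fun p => sum_congr rfl fun x _ => by simp only [WithLp.ofLp_add, Pi.add_apply]
  simp only [hcell, Complex.ofReal_sub, Complex.ofReal_one, add_sub_cancel]
  rw [← Complex.ofReal_prod, ← Real.exp_sum, ← sum_neg_distrib]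

omit [Fintype ι] [DecidableEq ι] [DecidableEq V] in
/-- **`Z_ψ(S) = ↑∫ e^{−A} dμ`**: the perturbed partition function of the road's shifted factors on `S` is the (real) fluctuation integral of
`e^{−Σ_{p∈S}Σ_{x∈cell p}w_x(ω_x+ψ_x)}`. [folklore] -/
theorem pertZ_road_shift_eq (μ : Measure (EuclideanSpace ℝ ι)) (cell : V → Finset ι) (w : ι → ℝ → ℝ) (S : Finset V)
    (ψ : EuclideanSpace ℝ ι) :
    pertZ μ (fun p ω => (((exp (-(∑ x ∈ cell p, w x ((ω + ψ) x))) - 1 : ℝ)) : ℂ)) S =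
      ((∫ ω : EuclideanSpace ℝ ι, exp (-(∑ p ∈ S, ∑ x ∈ cell p, w x (ω x + ψ x))) ∂μ : ℝ) : ℂ) := by
  unfold pertZ
  simp_rw [prod_one_add_road_factor cell w S _ ψ]
  exact integral_complex_ofReal

omit [Fintype ι] [DecidableEq ι] [DecidableEq V] in
/-- **The complex logarithm controls the real one**: `e^z = ↑r` with `0 < r` ⟹ `|log r| ≤ ‖z‖` (`‖e^z‖ = e^{Re z}`, `|Re z| ≤ ‖z‖`).
[folklore] -/
theorem abs_log_le_norm_of_exp_eq {z : ℂ} {r : ℝ} (hr : 0 < r) (h : Complex.exp z = (r : ℂ)) : |log r| ≤ ‖z‖ := by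
  have h1 : ‖Complex.exp z‖ = r := by rw [h, Complex.norm_real, Real.norm_of_nonneg hr.le]
  rw [Complex.norm_exp] at h1
  have h2 : z.re = log r := by rw [← h1, log_exp]
  rw [← h2]
  exact Complex.abs_re_le_norm z

/-- **`exp(log Z_ψ(C)) = Z_ψ(C)` ON THE SMALL-FIELD REGION** for cell-measurable regulated factors (`Γ ⪰ 0` of range `ρ`, `Γ ⪯ γ_op·1`,
diagonal `≤ γ`; disjoint cells of `≤ v` sites; `R` symmetric covering `ρ`-closeness with `≤ Δ` neighbours; factors regulated and measurable on
`C`; `ψ` small on the cells of `C`; `e·ε_ΨA_τ^v(Δ+1)² ≤ 1∕2`): (289)'s KP branch on the cut-off shifted factors, then (296)'s locality.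
[folklore] -/
theorem shifted_exp_pertLogZ_on {Γ : Matrix ι ι ℝ} {γop γ : ℝ} (hΓ : Γ.PosSemidef)
    (hΓop : (γop • (1 : Matrix ι ι ℝ) - Γ).PosSemidef) (hdiag : ∀ i, Γ i i ≤ γ) (hγ : 0 ≤ γ) {dι : ι → ι → ℕ} {ρ : ℕ}
    (hfr : HasFiniteRange dι ρ Γ) (cell : V → Finset ι) (hdisj : ∀ p q, p ≠ q → Disjoint (cell p) (cell q)) {v : ℕ}
    (hv : ∀ p, (cell p).card ≤ v) {R : V → V → Prop} [DecidableRel R] [Std.Symm R]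
    (hR : ∀ (p p' : V) (x y : ι), x ∈ cell p → y ∈ cell p' → dι x y ≤ ρ → p = p' ∨ R p p') {nbr : V → Finset V} {Δ : ℕ}
    (hΔ : ∀ x, (nbr x).card ≤ Δ) (hnbr : ∀ x y, R x y → y ∈ nbr x)
    {g : V → EuclideanSpace ℝ ι → ℂ} {ε κ τ θ Ψ : ℝ} (hε : 0 ≤ ε) (hκ : 0 ≤ κ) (hτ : 0 < τ) (hθ0 : 0 < θ) (hθ1 : θ < 1)
    (hκθ : κ * (1 + τ) * γop ≤ θ) (C : Finset V)
    (hmeas : ∀ p ∈ C, Measurable[MeasurableSpace.comap (fun (ω : EuclideanSpace ℝ ι) (x : cell p) => ω x) inferInstance] (g p))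
    (hreg : ∀ p ∈ C, ∀ ω, ‖g p ω‖ ≤ ε * exp (κ * (∑ x ∈ cell p, ω x ^ 2) / 2)) (ψ : EuclideanSpace ℝ ι)
    (hψ : ∀ p ∈ C, ∑ x ∈ cell p, ψ x ^ 2 ≤ Ψ ^ 2)
    (hsmall : Real.exp 1 * ((ε * exp (κ * (1 + τ⁻¹) * Ψ ^ 2 / 2)) * ((1 - θ) ^ (-(κ * (1 + τ) * γ / (2 * θ)))) ^ v) *
      ((Δ : ℝ) + 1) ^ 2 ≤ 1 / 2) :
    Complex.exp (pertLogZ (multivariateGaussian 0 Γ) (fun p ω => g p (ω + ψ)) R C) =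
      pertZ (multivariateGaussian 0 Γ) (fun p ω => g p (ω + ψ)) C := by
  rw [← pertLogZ_cutoff (multivariateGaussian 0 Γ) (fun p ω => g p (ω + ψ)) R C,
    ← pertZ_cutoff (multivariateGaussian 0 Γ) (fun p ω => g p (ω + ψ)) C]
  exact regulated_exp_pertLogZ hΓ hΓop hdiag hγ hfr cell hdisj hv hR hΔ hnbr (mul_nonneg hε (exp_pos _).le)
    (mul_nonneg hκ (by linarith)) hθ0 hθ1 hκθ (shifted_measurable cell (cutoff_measurable cell C hmeas) ψ)
    (cutoff_shifted_regulated cell hε hκ hτ C hreg ψ hψ) hsmall C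

omit [Fintype ι] [DecidableEq ι] [DecidableEq V] in
/-- **(305)'s reversed split at `θ = ½`**: on a nonzero measure space, for measurable `A, B` with `e^{−A}`, `e^{−(A+B)}`, `e^{−(A−B)}`
integrable: `2·log ∫e^{−A} − log ∫e^{−(A−B)} ≤ log ∫e^{−(A+B)}`. [folklore] -/
theorem two_mul_log_sub_le {Ω : Type*} [MeasurableSpace Ω] {μ : Measure Ω} [NeZero μ] {A B : Ω → ℝ} (hA : Measurable A)
    (hB : Measurable B) (hI0 : Integrable (fun ω => exp (-A ω)) μ) (hI : Integrable (fun ω => exp (-(A ω + B ω))) μ)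
    (hI' : Integrable (fun ω => exp (-(A ω - B ω))) μ) :
    2 * log (∫ ω, exp (-A ω) ∂μ) - log (∫ ω, exp (-(A ω - B ω)) ∂μ) ≤ log (∫ ω, exp (-(A ω + B ω)) ∂μ) := by
  have hhalf : (1 / 2 : ℝ) / (1 - 1 / 2) = 1 := by norm_num
  have hI'' : Integrable (fun ω => exp (-(A ω - (1 / 2 : ℝ) / (1 - 1 / 2) * B ω))) μ := by
    simpa only [hhalf, one_mul] using hI'
  have h := le_log_integral_exp_neg_add hA hB (by norm_num : (0 : ℝ) < 1 / 2) (by norm_num : (1 / 2 : ℝ) < 1) hI0 hI hI''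
  simp only [hhalf, one_mul] at h
  have h2 : (1 : ℝ) / (1 / 2) = 2 := by norm_num
  have h3 : (1 - 1 / 2 : ℝ) / (1 / 2) = 1 := by norm_num
  rw [h2, h3, one_mul] at h
  exact h

/-! ## §2. THE END — the small-field gas is real: `|log ∫e^{−A}| ≤ #S(Δ+1)2e·ε_ΨA_τ^v` -/

/-- **THE SMALL-FIELD GAS IS REAL AND `O(ε)`-EXTENSIVE.**  `Γ ⪰ 0` of range `ρ`, `Γ ⪯ γ_op·1`, diagonal `≤ γ` (`γ ≥ 0`); disjoint cells of
`≤ v` sites; `R` symmetric covering `ρ`-closeness with `≤ Δ` neighbours; measurable remainders with `w_x(t) ≥ −κ₀t²` (`κ₀ ≥ 0`) and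
`|w_x(t)| ≤ c₃|t|³` for `|t| ≤ h` (`c₃, h ≥ 0`); `2κ₀ ≤ κ`, `0 < τ`, `0 < θ < 1`, `κ(1+τ)γ_op ≤ θ`; `Σ_{x∈cell p}ψ_x² ≤ Ψ²` FOR THE CELLS
`p ∈ S`; `e·ε_Ψ(h)A_τ^v·(Δ+1)² ≤ 1∕2` ⟹
`|log ∫ e^{−Σ_{p∈S}Σ_{x∈cell p}w_x(ω_x+ψ_x)} dN(0,Γ)| ≤ #S·(Δ+1)·2e·ε_Ψ(h)A_τ^v`. [folklore] -/
theorem abs_log_integral_smallField_le {Γ : Matrix ι ι ℝ} {γop γ : ℝ} (hΓ : Γ.PosSemidef)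
    (hΓop : (γop • (1 : Matrix ι ι ℝ) - Γ).PosSemidef) (hdiag : ∀ i, Γ i i ≤ γ) (hγ : 0 ≤ γ) {dι : ι → ι → ℕ} {ρ : ℕ}
    (hfr : HasFiniteRange dι ρ Γ) (cell : V → Finset ι) (hdisj : ∀ p q, p ≠ q → Disjoint (cell p) (cell q)) {v : ℕ}
    (hv : ∀ p, (cell p).card ≤ v) {R : V → V → Prop} [DecidableRel R] [Std.Symm R]
    (hR : ∀ (p p' : V) (x y : ι), x ∈ cell p → y ∈ cell p' → dι x y ≤ ρ → p = p' ∨ R p p') {nbr : V → Finset V} {Δ : ℕ}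
    (hΔ : ∀ x, (nbr x).card ≤ Δ) (hnbr : ∀ x y, R x y → y ∈ nbr x)
    (w : ι → ℝ → ℝ) (hw : ∀ x, Measurable (w x)) {κ₀ c₃ h κ τ θ Ψ : ℝ} (hκ₀ : 0 ≤ κ₀) (hc₃ : 0 ≤ c₃) (hh : 0 ≤ h)
    (hstab : ∀ x, ∀ t : ℝ, -(κ₀ * t ^ 2) ≤ w x t) (hcub : ∀ x, ∀ t : ℝ, |t| ≤ h → |w x t| ≤ c₃ * |t| ^ 3) (hκ : 2 * κ₀ ≤ κ)
    (hτ : 0 < τ) (hθ0 : 0 < θ) (hθ1 : θ < 1) (hκθ : κ * (1 + τ) * γop ≤ θ) (S : Finset V) (ψ : EuclideanSpace ℝ ι)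
    (hψ : ∀ p ∈ S, ∑ x ∈ cell p, ψ x ^ 2 ≤ Ψ ^ 2)
    (hsmall : Real.exp 1 * (((max (exp (c₃ * v * h ^ 3) - 1) (2 * exp (-((κ / 2 - κ₀) * h ^ 2)))) *
      exp (κ * (1 + τ⁻¹) * Ψ ^ 2 / 2)) * ((1 - θ) ^ (-(κ * (1 + τ) * γ / (2 * θ)))) ^ v) * ((Δ : ℝ) + 1) ^ 2 ≤ 1 / 2) :
    |log (∫ ω : EuclideanSpace ℝ ι, exp (-(∑ p ∈ S, ∑ x ∈ cell p, w x (ω x + ψ x))) ∂(multivariateGaussian 0 Γ))| ≤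
      S.card * ((Δ : ℝ) + 1) * (2 * (Real.exp 1 * (((max (exp (c₃ * v * h ^ 3) - 1) (2 * exp (-((κ / 2 - κ₀) * h ^ 2)))) *
        exp (κ * (1 + τ⁻¹) * Ψ ^ 2 / 2)) * ((1 - θ) ^ (-(κ * (1 + τ) * γ / (2 * θ)))) ^ v))) := by
  set μ := multivariateGaussian 0 Γ with hμ
  set g : V → EuclideanSpace ℝ ι → ℂ := fun p ω => (((exp (-(∑ x ∈ cell p, w x (ω x))) - 1 : ℝ)) : ℂ) with hg
  have hκ' : 0 ≤ κ := by linarith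
  have hreg0 : ∀ p ω, ‖g p ω‖ ≤ max (exp (c₃ * v * h ^ 3) - 1) (2 * exp (-((κ / 2 - κ₀) * h ^ 2))) *
      exp (κ * (∑ x ∈ cell p, ω x ^ 2) / 2) := road_factor_norm_le cell hv w hκ₀ hc₃ hh hstab hcub hκ
  have hmeas0 := road_factor_measurable cell w hw
  have hε0 := road_eps_nonneg c₃ v h κ κ₀
  -- `exp(log Z) = Z` and `‖log Z‖ ≤ …` for the shifted factors on `S`
  have hexp := shifted_exp_pertLogZ_on hΓ hΓop hdiag hγ hfr cell hdisj hv hR hΔ hnbr hε0 hκ' hτ hθ0 hθ1 hκθ S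
    (fun p _ => hmeas0 p) (fun p _ ω => hreg0 p ω) ψ hψ hsmall
  have hnorm := shifted_norm_pertLogZ_le_on hΓ hΓop hdiag hγ cell hdisj hv symm_of_inst hΔ hnbr hε0 hκ' hτ hθ0 hθ1 hκθ S
    (fun p _ ω => hreg0 p ω) ψ hψ hsmall
  -- `Z = ↑∫e^{−A}`
  have hZ : pertZ μ (fun p ω => g p (ω + ψ)) S =
      ((∫ ω : EuclideanSpace ℝ ι, exp (-(∑ p ∈ S, ∑ x ∈ cell p, w x (ω x + ψ x))) ∂μ : ℝ) : ℂ) :=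
    pertZ_road_shift_eq μ cell w S ψ
  rw [hZ] at hexp
  -- positivity of the real integral
  have hne : pertZ μ (fun p ω => g p (ω + ψ)) S ≠ 0 := by rw [hZ, ← hexp]; exact Complex.exp_ne_zero _
  have hr0 : 0 ≤ ∫ ω : EuclideanSpace ℝ ι, exp (-(∑ p ∈ S, ∑ x ∈ cell p, w x (ω x + ψ x))) ∂μ :=
    integral_nonneg fun ω => (exp_pos _).le
  have hr : 0 < ∫ ω : EuclideanSpace ℝ ι, exp (-(∑ p ∈ S, ∑ x ∈ cell p, w x (ω x + ψ x))) ∂μ := by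
    refine lt_of_le_of_ne hr0 fun h0 => hne ?_
    rw [hZ, ← h0, Complex.ofReal_zero]
  exact (abs_log_le_norm_of_exp_eq hr hexp).trans hnorm

/-! ## §3. The large-field logarithm (stability side) -/

/-- **THE LARGE-FIELD LOGARITHM, UPPER** ((297) read on `log`): `Γ ⪰ 0`, `Γ ⪯ γ_op·1`, `Γ(x,x) ≤ γ` on `Y`; remainders with
`w_x(t) ≥ −κ₀t²` (`κ₀ ≥ 0`), measurable; `0 < τ`, `0 < θ < 1`, `2κ₀(1+τ)γ_op ≤ θ` ⟹ for every `ψ`: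
`log ∫ e^{−Σ_{x∈Y}w_x(ω_x+ψ_x)} dN(0,Γ) ≤ #Y·(2κ₀(1+τ)γ∕(2θ))·(−log(1−θ)) + κ₀(1+τ⁻¹)Σ_{x∈Y}ψ_x²`. [folklore] -/
theorem log_integral_largeField_le {Γ : Matrix ι ι ℝ} {γop γ : ℝ} (hΓ : Γ.PosSemidef)
    (hΓop : (γop • (1 : Matrix ι ι ℝ) - Γ).PosSemidef) (Y : Finset ι) (hdiag : ∀ i ∈ Y, Γ i i ≤ γ) (w : ι → ℝ → ℝ)
    (hw : ∀ x, Measurable (w x)) {κ₀ τ θ : ℝ} (hκ₀ : 0 ≤ κ₀) (hτ : 0 < τ) (hθ0 : 0 < θ) (hθ1 : θ < 1)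
    (hκθ : 2 * κ₀ * (1 + τ) * γop ≤ θ) (hstab : ∀ x, ∀ t : ℝ, -(κ₀ * t ^ 2) ≤ w x t) (ψ : ι → ℝ) :
    log (∫ ω : EuclideanSpace ℝ ι, exp (-(∑ x ∈ Y, w x (ω x + ψ x))) ∂(multivariateGaussian 0 Γ)) ≤
      Y.card * (2 * κ₀ * (1 + τ) * γ / (2 * θ)) * (-log (1 - θ)) + κ₀ * (1 + τ⁻¹) * ∑ x ∈ Y, ψ x ^ 2 := by
  have hup := integral_exp_neg_le hΓ hΓop Y hdiag w hκ₀ hτ hθ0 hθ1 hκθ hstab ψ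
  have hZpos : 0 < ∫ ω : EuclideanSpace ℝ ι, exp (-(∑ x ∈ Y, w x (ω x + ψ x))) ∂(multivariateGaussian 0 Γ) :=
    integral_exp_pos (integrable_exp_neg hΓ hΓop Y w hw hκ₀ hτ hθ1 hκθ hstab ψ)
  have h1θ : 0 < 1 - θ := by linarith
  have hApos : 0 < (1 - θ) ^ (-(2 * κ₀ * (1 + τ) * γ / (2 * θ))) := rpow_pos_of_pos h1θ _
  have h := log_le_log hZpos hup
  rw [log_mul (pow_pos hApos _).ne' (exp_pos _).ne', log_exp, log_pow, log_rpow h1θ] at h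
  have heq : (Y.card : ℝ) * (-(2 * κ₀ * (1 + τ) * γ / (2 * θ)) * log (1 - θ)) =
      Y.card * (2 * κ₀ * (1 + τ) * γ / (2 * θ)) * (-log (1 - θ)) := by ring
  linarith [heq]

/-! ## §4. Toy -/

/-- Toy (§1): `e^z = ↑1` forces `|log 1| ≤ ‖z‖`. -/
example {z : ℂ} (h : Complex.exp z = ((1 : ℝ) : ℂ)) : |log 1| ≤ ‖z‖ := abs_log_le_norm_of_exp_eq one_pos h

end Summit.QuantumFields.BalabanUV.T4Continuum.NE7b.SupSmallFieldGasReal
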